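import Mathlib
import HarnessLib
import Summits.HubbardSuperconductivity.HubbardSuperconductivity.Theorems.KLProgrammeKLRegimeEngineLastRespSymbols
import Literature.MathematicalPhysics.QuantumLattice.HubbardUVSymbolDressingFactorJetsGevrey

/-!
# K3 gen-8-FLOW (stmt 20437, stub (C), located item #20, cure (δ′) «LAST-STEP SWAP», layer F3e): GEVREY SUPS OF THE THREE LAST-STEP SYMBOLS —
# the `hDg_X`/`hA₀_X` inputs of `lastResponse_bracket` from the band-pair tables of `(u, v) = (e_{K_{n_β}}, K_{n_β} ⊖ K_N)`

Cell gate-hubbard-kl, seat p2 g17.  The three symbols of `…EngineLastRespSymbols` (`−J₂`, `J₁`, `−i·J₁` of the REVERSED pair, weight one, `c = βL²`,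
`Λ = Λ_N`, `ω = ω₀`) are instances of `Literature.….HubbardUVSymbolDressingFactorJetsGevrey`'s `J₂`, `J₁` with `u := frameLevel μ Ko`, `v := evalM (Ko ⊖ Kn)`:
given the Gevrey-2 cutoff table `‖χ₂^{(l)}‖ ≤ X₀(l!)²C_χ^l`, band tables `‖Dⁱu‖ ≤ i!·E_uⁱ` (`1 ≤ i ≤ n`), `‖Dⁱv‖ ≤ δ·i!·F_vⁱ` (`i ≤ n`) and `δ ≤ Λ_N/4`
(p2 g14's parametrised envelopes `frameLevel_flowFrame_jets_of_env` / `flowMismatch_jets_of_env` supply them at the flow frames), every Fréchet jet of order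
`n` of the three symbols is bounded UNIFORMLY in `q` by the printed Gevrey-2 expressions — the `Dg_X` (order `Mg`) and, at `n = 0`, the `A₀_X` of the bracket.

* `lastNegJ₂_sup_le_gevrey`, `lastJ₁_sup_le_gevrey`, `lastNegIJ₁_sup_le_gevrey` (all orders `n`, all `q`).

Proofs only (sign/`−i`-bookkeeping on the Literature lemmas); no definitions; nothing asserts superconductivity.
Refs: BGM 2006 §2.2 (2.23), (2.27)–(2.28), (2.36aa) [cite: BenfattoGiulianiMastropietro2006]; FST 1996 §1 [cite: FeldmanSalmhoferTrubowitz1996].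
-/

noncomputable section

namespace Summit.HubbardSuperconductivity.HubbardSuperconductivity.Theorems.EngineV8

set_option linter.dupNamespace false -- summit = problem name (single-conjunct summit), D-0017

open Complex Real Finset Literature.MathematicalPhysics.QuantumLattice Literature.Probability.LatticeModels
open Summit.HubbardSuperconductivity.HubbardSuperconductivity.Theorems.KLRegimeSplit
open Summit.HubbardSuperconductivity.HubbardSuperconductivity.Theorems.DispersionFlow
open Summit.HubbardSuperconductivity.HubbardSuperconductivity.Theorems.KLProgrammeLegKernels
open scoped Nat

variable {L M : ℕ} [NeZero L] [NeZero M]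

section Sups

variable {β : ℝ} (hβ : 0 < β) (μ : ℝ) (Ko Kn : TrigPolyC4v) {N : ℕ} {n : ℕ} {X₀ Cχ : ℝ} (hX1 : 1 ≤ X₀) (hC : 0 ≤ Cχ)
  (hXG : ∀ l ≤ n, ∀ x : ℝ, ‖iteratedFDeriv ℝ l salmhoferCutoff x‖ ≤ X₀ * ((l ! : ℝ)) ^ 2 * Cχ ^ l)
  {Eu Fv δ : ℝ} (hEu : 0 ≤ Eu) (hFv : 0 ≤ Fv) (hδ : 0 ≤ δ) (hδΛ : δ ≤ (klScale klE0 N) / 4)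
  (hDu : ∀ i, 1 ≤ i → i ≤ n → ∀ q : Momentum, ‖iteratedFDeriv ℝ i (frameLevel μ Ko) q‖ ≤ i ! * Eu ^ i)
  (hDv : ∀ i ≤ n, ∀ q : Momentum, ‖iteratedFDeriv ℝ i (evalM (fsub Ko Kn)) q‖ ≤ δ * i ! * Fv ^ i)
include hβ hX1 hC hXG hEu hFv hδ hδΛ hDu hDv

omit [NeZero L] in
/-- **Gevrey sup of `−J₂`** (the symbol of the `R_a` term), every order `n`, every `q`. -/
theorem lastNegJ₂_sup_le_gevrey (q : Momentum) :
    ‖iteratedFDeriv ℝ n (fun q : Momentum => ((((evalM (fsub Ko Kn) q * evalM (fsub Ko Kn) q) / (β * (L : ℝ) ^ 2) : ℝ)) : ℂ) * (((uvWeightFn (klScale klE0 N) (matsubaraFreq β M (omega0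
        M)) (frameLevel μ Ko q) : ℝ) : ℂ) * resolventFnXi (β * (L : ℝ) ^ 2) 0 (matsubaraFreq β M (omega0 M)) (frameLevel μ Ko q + uvWeightFn (klScale klE0 N) (matsubaraFreq β M (omega0
        M)) (frameLevel μ Ko q) * evalM (fsub Ko Kn) q))) q‖ ≤
      (δ * δ / |(β * (L : ℝ) ^ 2)|) * (X₀ * (|(β * (L : ℝ) ^ 2)| * (6 / (klScale klE0 N)))) * ((n ! : ℝ)) ^ 2 *
        (2 * (2 * Fv + 2 * (4 * (2 * (4 * Eu * (1 + 16 * (1 + Cχ) / (klScale klE0 N) * 1) + Fv)) * (1 + 6 / (klScale klE0 N) * ((klScale klE0 N) / 128 + X₀ * δ))))) ^ n := by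
  have hΛ : 0 < klScale klE0 N := by unfold klScale klE0; positivity
  have hω : matsubaraFreq β M (omega0 M) ≠ 0 := matsubaraFreq_ne_zero hβ.ne' _
  have hv0 : |evalM (fsub Ko Kn) q| ≤ δ := by
    have h := hDv 0 (Nat.zero_le _) q
    rw [norm_iteratedFDeriv_zero, Real.norm_eq_abs] at h
    simpa using h
  have h := norm_iteratedFDeriv_J₂_le_gevrey (E := Momentum) (c := (β * (L : ℝ) ^ 2)) (Λ := klScale klE0 N) (ω := matsubaraFreq β M (omega0 M)) hΛ hω hX1 hC hXG
    (contDiff_frameLevel μ Ko) (contDiff_evalM _) hEu hFv hδ hδΛ q hv0 (fun i h1 h2 => hDu i h1 h2 q) (fun i hi => hDv i hi q)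
  have e : (fun q : Momentum => -((((evalM (fsub Ko Kn) q * evalM (fsub Ko Kn) q) / (β * (L : ℝ) ^ 2) : ℝ)) : ℂ) *
        (((uvWeightFn (klScale klE0 N) (matsubaraFreq β M (omega0 M)) (frameLevel μ Ko q) : ℝ) : ℂ) * resolventFnXi (β * (L : ℝ) ^ 2) 0 (matsubaraFreq β M (omega0 M)) (frameLevel μ Ko
            q + uvWeightFn (klScale klE0 N) (matsubaraFreq β M (omega0 M)) (frameLevel μ Ko q) * evalM (fsub Ko Kn) q))) =
      -(fun q : Momentum => ((((evalM (fsub Ko Kn) q * evalM (fsub Ko Kn) q) / (β * (L : ℝ) ^ 2) : ℝ)) : ℂ) * (((uvWeightFn (klScale klE0 N) (matsubaraFreq β M (omega0 M)) (frameLevel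
          μ Ko q) : ℝ) : ℂ) * resolventFnXi (β * (L : ℝ) ^ 2) 0 (matsubaraFreq β M (omega0 M)) (frameLevel μ Ko q + uvWeightFn (klScale klE0 N) (matsubaraFreq β M (omega0 M))
          (frameLevel μ Ko q) * evalM (fsub Ko Kn) q))) := by
    funext q; simp only [Pi.neg_apply, neg_mul]
  rw [e, iteratedFDeriv_neg_apply, norm_neg] at h
  exact h

omit [NeZero L] in
/-- **Gevrey sup of `J₁`** (the symbol of the `R_b` term), every order `n`, every `q`. -/
theorem lastJ₁_sup_le_gevrey (q : Momentum) :
    ‖iteratedFDeriv ℝ n (fun q : Momentum => ((((evalM (fsub Ko Kn) q / (β * (L : ℝ) ^ 2) : ℝ)) : ℂ) * (((uvWeightFn (klScale klE0 N) (matsubaraFreq β M (omega0 M)) (frameLevel μ Ko q)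
        : ℝ) : ℂ) * resolventFnXi (β * (L : ℝ) ^ 2) 0 (matsubaraFreq β M (omega0 M)) (frameLevel μ Ko q + uvWeightFn (klScale klE0 N) (matsubaraFreq β M (omega0 M)) (frameLevel μ Ko q)
        * evalM (fsub Ko Kn) q))) * ((((evalM (fsub Ko Kn) q / (β * (L : ℝ) ^ 2) : ℝ)) : ℂ) * (((uvWeightFn (klScale klE0 N) (matsubaraFreq β M (omega0 M)) (frameLevel μ Ko q) : ℝ) :
        ℂ) * resolventFnXi (β * (L : ℝ) ^ 2) 0 (matsubaraFreq β M (omega0 M)) (frameLevel μ Ko q + uvWeightFn (klScale klE0 N) (matsubaraFreq β M (omega0 M)) (frameLevel μ Ko q) *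
        evalM (fsub Ko Kn) q))) - (2 : ℂ) * ((((evalM (fsub Ko Kn) q / (β * (L : ℝ) ^ 2) : ℝ)) : ℂ) * (((uvWeightFn (klScale klE0 N) (matsubaraFreq β M (omega0 M)) (frameLevel μ Ko q)
        : ℝ) : ℂ) * resolventFnXi (β * (L : ℝ) ^ 2) 0 (matsubaraFreq β M (omega0 M)) (frameLevel μ Ko q + uvWeightFn (klScale klE0 N) (matsubaraFreq β M (omega0 M)) (frameLevel μ Ko q)
        * evalM (fsub Ko Kn) q)))) q‖ ≤
      (δ / |(β * (L : ℝ) ^ 2)| * (X₀ * (|(β * (L : ℝ) ^ 2)| * (6 / (klScale klE0 N))))) * (δ / |(β * (L : ℝ) ^ 2)| * (X₀ * (|(β * (L : ℝ) ^ 2)| * (6 / (klScale klE0 N))))) * ((n ! : ℝ)) ^ 2 *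
          (2 * (2 * (2 * Fv + 2 * (4 * (2 * (4 * Eu * (1 + 16 * (1 + Cχ) / (klScale klE0 N) * 1) + Fv)) * (1 + 6 / (klScale klE0 N) * ((klScale klE0 N) / 128 + X₀ * δ)))))) ^ n +
        2 * ((δ / |(β * (L : ℝ) ^ 2)|) * (X₀ * (|(β * (L : ℝ) ^ 2)| * (6 / (klScale klE0 N)))) * ((n ! : ℝ)) ^ 2 *
          (2 * (2 * Fv + 2 * (4 * (2 * (4 * Eu * (1 + 16 * (1 + Cχ) / (klScale klE0 N) * 1) + Fv)) * (1 + 6 / (klScale klE0 N) * ((klScale klE0 N) / 128 + X₀ * δ))))) ^ n) := by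
  have hΛ : 0 < klScale klE0 N := by unfold klScale klE0; positivity
  have hω : matsubaraFreq β M (omega0 M) ≠ 0 := matsubaraFreq_ne_zero hβ.ne' _
  have hv0 : |evalM (fsub Ko Kn) q| ≤ δ := by
    have h := hDv 0 (Nat.zero_le _) q
    rw [norm_iteratedFDeriv_zero, Real.norm_eq_abs] at h
    simpa using h
  exact norm_iteratedFDeriv_J₁_le_gevrey (E := Momentum) (c := (β * (L : ℝ) ^ 2)) (Λ := klScale klE0 N) (ω := matsubaraFreq β M (omega0 M)) hΛ hω hX1 hC hXG
    (contDiff_frameLevel μ Ko) (contDiff_evalM _) hEu hFv hδ hδΛ q hv0 (fun i h1 h2 => hDu i h1 h2 q) (fun i hi => hDv i hi q)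

omit [NeZero L] in
/-- **Gevrey sup of `−i·J₁`** (the symbol of the `R_c` term): the same bound as `J₁` (`‖−i‖ = 1`). -/
theorem lastNegIJ₁_sup_le_gevrey (q : Momentum) :
    ‖iteratedFDeriv ℝ n (fun q : Momentum => -I * (((((evalM (fsub Ko Kn) q / (β * (L : ℝ) ^ 2) : ℝ)) : ℂ) * (((uvWeightFn (klScale klE0 N) (matsubaraFreq β M (omega0 M)) (frameLevel μ
        Ko q) : ℝ) : ℂ) * resolventFnXi (β * (L : ℝ) ^ 2) 0 (matsubaraFreq β M (omega0 M)) (frameLevel μ Ko q + uvWeightFn (klScale klE0 N) (matsubaraFreq β M (omega0 M)) (frameLevel μ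
        Ko q) * evalM (fsub Ko Kn) q))) * ((((evalM (fsub Ko Kn) q / (β * (L : ℝ) ^ 2) : ℝ)) : ℂ) * (((uvWeightFn (klScale klE0 N) (matsubaraFreq β M (omega0 M)) (frameLevel μ Ko q) :
        ℝ) : ℂ) * resolventFnXi (β * (L : ℝ) ^ 2) 0 (matsubaraFreq β M (omega0 M)) (frameLevel μ Ko q + uvWeightFn (klScale klE0 N) (matsubaraFreq β M (omega0 M)) (frameLevel μ Ko q) *
        evalM (fsub Ko Kn) q))) - (2 : ℂ) * ((((evalM (fsub Ko Kn) q / (β * (L : ℝ) ^ 2) : ℝ)) : ℂ) * (((uvWeightFn (klScale klE0 N) (matsubaraFreq β M (omega0 M)) (frameLevel μ Ko q)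
        : ℝ) : ℂ) * resolventFnXi (β * (L : ℝ) ^ 2) 0 (matsubaraFreq β M (omega0 M)) (frameLevel μ Ko q + uvWeightFn (klScale klE0 N) (matsubaraFreq β M (omega0 M)) (frameLevel μ Ko q)
        * evalM (fsub Ko Kn) q))))) q‖ ≤
      (δ / |(β * (L : ℝ) ^ 2)| * (X₀ * (|(β * (L : ℝ) ^ 2)| * (6 / (klScale klE0 N))))) * (δ / |(β * (L : ℝ) ^ 2)| * (X₀ * (|(β * (L : ℝ) ^ 2)| * (6 / (klScale klE0 N))))) * ((n ! : ℝ)) ^ 2 *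
          (2 * (2 * (2 * Fv + 2 * (4 * (2 * (4 * Eu * (1 + 16 * (1 + Cχ) / (klScale klE0 N) * 1) + Fv)) * (1 + 6 / (klScale klE0 N) * ((klScale klE0 N) / 128 + X₀ * δ)))))) ^ n +
        2 * ((δ / |(β * (L : ℝ) ^ 2)|) * (X₀ * (|(β * (L : ℝ) ^ 2)| * (6 / (klScale klE0 N)))) * ((n ! : ℝ)) ^ 2 *
          (2 * (2 * Fv + 2 * (4 * (2 * (4 * Eu * (1 + 16 * (1 + Cχ) / (klScale klE0 N) * 1) + Fv)) * (1 + 6 / (klScale klE0 N) * ((klScale klE0 N) / 128 + X₀ * δ))))) ^ n) := by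
  have hω : matsubaraFreq β M (omega0 M) ≠ 0 := matsubaraFreq_ne_zero hβ.ne' _
  have hJ := contDiff_lastJ₁ μ Ko Kn (β * (L : ℝ) ^ 2) (klScale klE0 N) (matsubaraFreq β M (omega0 M)) hω
  have e : (fun q : Momentum => -I * (((((evalM (fsub Ko Kn) q / (β * (L : ℝ) ^ 2) : ℝ)) : ℂ) * (((uvWeightFn (klScale klE0 N) (matsubaraFreq β M (omega0 M)) (frameLevel μ Ko q) : ℝ) :
      ℂ) * resolventFnXi (β * (L : ℝ) ^ 2) 0 (matsubaraFreq β M (omega0 M)) (frameLevel μ Ko q + uvWeightFn (klScale klE0 N) (matsubaraFreq β M (omega0 M)) (frameLevel μ Ko q) * evalM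
      (fsub Ko Kn) q))) * ((((evalM (fsub Ko Kn) q / (β * (L : ℝ) ^ 2) : ℝ)) : ℂ) * (((uvWeightFn (klScale klE0 N) (matsubaraFreq β M (omega0 M)) (frameLevel μ Ko q) : ℝ) : ℂ) *
      resolventFnXi (β * (L : ℝ) ^ 2) 0 (matsubaraFreq β M (omega0 M)) (frameLevel μ Ko q + uvWeightFn (klScale klE0 N) (matsubaraFreq β M (omega0 M)) (frameLevel μ Ko q) * evalM (fsub
      Ko Kn) q))) - (2 : ℂ) * ((((evalM (fsub Ko Kn) q / (β * (L : ℝ) ^ 2) : ℝ)) : ℂ) * (((uvWeightFn (klScale klE0 N) (matsubaraFreq β M (omega0 M)) (frameLevel μ Ko q) : ℝ) : ℂ) *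
      resolventFnXi (β * (L : ℝ) ^ 2) 0 (matsubaraFreq β M (omega0 M)) (frameLevel μ Ko q + uvWeightFn (klScale klE0 N) (matsubaraFreq β M (omega0 M)) (frameLevel μ Ko q) * evalM (fsub
      Ko Kn) q))))) =
      fun q => (-I) • (fun q : Momentum => ((((evalM (fsub Ko Kn) q / (β * (L : ℝ) ^ 2) : ℝ)) : ℂ) * (((uvWeightFn (klScale klE0 N) (matsubaraFreq β M (omega0 M)) (frameLevel μ Ko q) :
          ℝ) : ℂ) * resolventFnXi (β * (L : ℝ) ^ 2) 0 (matsubaraFreq β M (omega0 M)) (frameLevel μ Ko q + uvWeightFn (klScale klE0 N) (matsubaraFreq β M (omega0 M)) (frameLevel μ Ko q)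
          * evalM (fsub Ko Kn) q))) * ((((evalM (fsub Ko Kn) q / (β * (L : ℝ) ^ 2) : ℝ)) : ℂ) * (((uvWeightFn (klScale klE0 N) (matsubaraFreq β M (omega0 M)) (frameLevel μ Ko q) : ℝ) :
          ℂ) * resolventFnXi (β * (L : ℝ) ^ 2) 0 (matsubaraFreq β M (omega0 M)) (frameLevel μ Ko q + uvWeightFn (klScale klE0 N) (matsubaraFreq β M (omega0 M)) (frameLevel μ Ko q) *
          evalM (fsub Ko Kn) q))) - (2 : ℂ) * ((((evalM (fsub Ko Kn) q / (β * (L : ℝ) ^ 2) : ℝ)) : ℂ) * (((uvWeightFn (klScale klE0 N) (matsubaraFreq β M (omega0 M)) (frameLevel μ Ko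
          q) : ℝ) : ℂ) * resolventFnXi (β * (L : ℝ) ^ 2) 0 (matsubaraFreq β M (omega0 M)) (frameLevel μ Ko q + uvWeightFn (klScale klE0 N) (matsubaraFreq β M (omega0 M)) (frameLevel μ
          Ko q) * evalM (fsub Ko Kn) q)))) q := by
    funext q; simp only [smul_eq_mul]
  rw [e, iteratedFDeriv_const_smul_apply' (hJ.contDiffAt.of_le (by exact_mod_cast le_top)), norm_smul, norm_neg, Complex.norm_I, one_mul]
  exact lastJ₁_sup_le_gevrey hβ μ Ko Kn hX1 hC hXG hEu hFv hδ hδΛ hDu hDv q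

end Sups

end Summit.HubbardSuperconductivity.HubbardSuperconductivity.Theorems.EngineV8

end
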